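import Mathlib
import HarnessLib
import HarnessLib.Audit
import Summits.NavierStokesRegularity.Statement
import Literature.Analysis.FluidPDE.ClassicalSolution
import Literature.Analysis.FluidPDE.LerayHopf
import Literature.Analysis.FluidPDE.SuitableWeak
import Literature.Analysis.FluidPDE.MildSolutions
import Literature.Analysis.FluidPDE.KatoMaximalTime
import Literature.Analysis.FluidPDE.NSKatoToClayHolds
import Literature.Analysis.FluidPDE.KNSSNoAxisymmetricTypeIHolds
import Literature.Analysis.FluidPDE.SelfSimilar
import Literature.Analysis.FluidPDE.SelfSimilarLiouville
import Literature.Analysis.FluidPDE.KatoViscosityScaling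
import Literature.Analysis.FluidPDE.KatoSymmetryCovariance
import Summits.NavierStokesRegularity.NavierStokesRegularity.Theses.RootDecompMarginalRate
import Summits.NavierStokesRegularity.NavierStokesRegularity.Theorems.MarginalTypeICriticalViscosityExists
import Summits.NavierStokesRegularity.NavierStokesRegularity.Theorems.BlowupAssembly
import Summits.NavierStokesRegularity.NavierStokesRegularity.Theorems.BlowupBlowupClayNonuniquenessRefutation
import Summits.NavierStokesRegularity.NavierStokesRegularity.Theorems.NoBlowupToClay
import Summits.NavierStokesRegularity.NavierStokesRegularity.Theorems.PumpContinuationEulerProximatePumpTruncationBridgeTypeI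
import Summits.NavierStokesRegularity.NavierStokesRegularity.Theorems.DssFarFieldSlavingBlowupTypeIDssProfileGaussianSmallTypeI
import Summits.NavierStokesRegularity.NavierStokesRegularity.Theorems.DssFarFieldSlavingBlowupTypeIDssProfileFixedTwistEmpty
import Summits.NavierStokesRegularity.NavierStokesRegularity.Theorems.DssFarFieldSlavingBlowupTypeIDssProfileAxisymmetricEmpty
import Summits.NavierStokesRegularity.NavierStokesRegularity.Theorems.RootDecompMarginalRateMarginalReduction
import HarnessLib.Audit.Status.Attr

/-!
Route: RootDecompThresholdSaddle

# Route RootDecompThresholdSaddle — Root decomposition g3 under N4's BLOCKER 1217 inside the g6 lean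
frame — Clay (A) ⟸ R ∧ LBE ∧ NMT ∧ PER ∧ W — «THE THRESHOLD SADDLE» (the lean Type-I threshold
echoes: its vertex tangent flow is a Type-I rotated-DSS orbit, and Tsai's wall says there is none)

ROOT DECOMPOSITION CELL decomp-ns (D-0178/D-0179, RESIDUAL MODE, blocker-first), node booked by
route-writer decomp-ns-writer-1 (g3): the critic-CLEARED lens-4 (g7)
node ThresholdSaddle («minimal counterexample / extremal reduction», run on N4's BLOCKER P1 =
NoTypeIBlowup stmt-NavierStokesRegularity-1217 INSIDE the lean frame of
g6 = route RootDecompLeanestSingularity; CRITIC-LEDGER row 62 CLEARED 2026-08-30T05:58:55Z). PARENT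
POINTERS: refines N4 `route-NavierStokesRegularity-RootDecompMarginalRate`
at its blocker :1217 (REPLACED here by PER ∧ W; kernel `pieces_of_noTypeI` 1217 ⟹ PER ∧ W and
`noTypeI_iff_pieces` 1217 ⟺ PER ∧ W given R ∧ NMT) and sits
UNDER N14 `route-NavierStokesRegularity-RootDecompLeanestSingularity` (R = stmt-25947, LBE =
stmt-29109, NMT = stmt-29108 carried VERBATIM, dedup by
signature); concludes the ROOT `NavierStokesRegularity` (no `--refines` verb; child closings are the
lens theorems `closes_child`, `closes_N4`, `n4_assembly_via_g7`).

THESIS. It suffices to show X = R ∧ LBE ∧ NMT ∧ PER ∧ W, where R (N4, PROVED), LBE (N14, PROVED in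
lens) and NMT (N14's residual: the ε-lean marginal blow-up is
Type I) are inherited, and the blocker «no Type-I blow-up» is SPLIT, inside the lean frame, into
- PER (`ThresholdTangentPeriodicity`, crux r2, NEW, DECLARED RESIDUAL): there is ε > 0 such that
every MARGINAL, ε-LEAN maximal smooth Leray–Hopf solution of
  finite lifespan T from a rapidly decaying datum that blows up at the TYPE-I rate has, at some
point x₀, a VERTEX TANGENT FLOW U (pointwise limit on s < 0 of the
  ν-normalised parabolic zooms lam·u(T + lam²ν s, x₀ + lam ν y), lam → 0⁺) lying in the NONTRIVIAL
TYPE-I ROTATED-DSS CLASS: factor c > 1, linear isometry R,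
  ancient mild (ν = 1), measurable slices, (c, R)-rotated discretely self-similar, Type-I space–time
bound ‖U t x‖ ≤ C₀/(‖x‖ + √(−t)), not a.e. trivial —
  i.e. the extremal threshold singularity ECHOES (a closed orbit of the scaling flow in similarity
variables);
- W (`TypeIDssWall`, crux r4, the DOOR = the tree wall
`Literature.Analysis.FluidPDE.TypeIDSSLiouvilleConjecture` VERBATIM = the un-negated
  `DssFarFieldSlaving.BlowupTypeIDssProfile` stmt-0155 = `Blowup.TypeIDssLiouville` stmt-10721,
re-attached): for every factor c, the plain and every rotated
  Type-I c-DSS Liouville statement hold — that class is EMPTY (Tsai GSM 192 Conj. 8.8–8.9;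
Bradshaw–Tsai 2017 §5 OP 5.1).
Lean: `theorem closes (hR : MarginalReduction) (hX : LeanBadDatumExists) (hL : LeanThresholdIsTypeI)
(hP : ThresholdTangentPeriodicity) (hW : TypeIDssWall) :
NavierStokesRegularity` — FIVE binders, all consumed: Kato-global data get Clay solutions (landed
`clay_solution_of_hasGlobalKatoSolution_holds`); otherwise LBE
gives a min(ε_NMT, ε_PER)-lean bad Clay datum w, R its marginal blow-up (u, p, T) at νc ≥ ν
(leanness persists up the ray and is antitone in ε), NMT makes it
Type I, PER produces the nontrivial Type-I RDSS tangent flow U, and W says U is a.e. trivial —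
contradiction (verbatim the lens kernel `closes`, HOME/decomp-ns-lens-4/ThresholdSaddle.lean sha256
2848ced3748364acfb5de9736fa564c7064a205b6e6e1ca57186d6bba9352676 (619 lines, lean rc 0 / 0 err / 0
warn / 0 sorry; axioms(closes) {propext, Classical.choice, Quot.sound})).

DEPENDENCY SHAPE. X = R ∧ LBE ∧ NMT ∧ PER ∧ W; R, LBE PROVED; NMT = N14's declared residual; PER NEW
residual; W the attacked door. Kernel accounting (lens §6):
S ⟹ NMT ∧ PER ∧ W (`pieces_of_root`; S ⟹ W because Tsai's wall is a CONSEQUENCE of Clay (A) in the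
tree: truncation bridge 14478 + uniqueness), given R:
S ⟺ NMT ∧ PER ∧ W (`root_iff_pieces`, EXACT), given R ∧ NMT: 1217 ⟺ PER ∧ W (`noTypeI_iff_pieces`,
EXACT AT THE BLOCKER). Each piece strictly below 1217:
1217 ⟹ W (kernel `wall_of_noTypeI` through the PROVED bridge `dssTruncationBridgeTypeI_proof`), 1217
⟹ PER (vacuity); PER and W fail in DISJOINT pictures —
W dies iff a nontrivial Type-I DSS orbit exists at all (then by bridge 14478 a Clay Type-I blow-up
exists and essentially the summit falls), PER dies iff the
lean Type-I threshold has NO asymptotically periodic vertex tangent flow (quasi-periodic / weakly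
mixing Type-I tangent flows — the «new regimes» of
RecurrentLiouville stmt-1589 — or periodic ones without SPACE–time Type-I decay). The separating
picture PER ∧ ¬1217 ∧ ¬W is exactly what every computed
critical solution looks like (census K8/K16: log-periodic cascade, one unstable multiplier ≈ 1.31 of
the stage map, threshold = its stable manifold; Choptuik
1993 DSS critical collapse, echoing period Δ ≈ 3.44). NS-level strictness UNDECIDED(tests T-saddle /
T-lean).
THE LEVER (why PER ∧ W is easier than 1217). 1217 must exclude EVERY Type-I blow-up; here the Type-I
blow-up is (a) MARGINAL and (b) LEAN — the ω-limit of a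
codimension-one threshold under the scaling flow, with the inductive hypothesis one factor 1+ε below
(N14 `NearMinimal.hasGlobalKatoSolution_of_lt`) forbidding a
second unstable direction — so PER asks only for the CLOSING-LEMMA step «recurrent ⟹ periodic» at an
extremal threshold (recurrence of Type-I profiles is the tree
THEOREM `RecurrentProfiles.RecurrentReduction`, stmt-1590), and W is a LIOUVILLE problem for ONE
rigid class with a ladder of six in-tree theorems and a named open
top (coarse ratio at large constant, no symmetry).

PIECE TAGS (census HOME/census/COSTUME-CENSUS-v4.md sha256
7e075824e86e88f341b09271c8623cffa11ee5eb8c58a0e7ff9d4527826b17a3 (.json 223d7603…);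
HOME/census/CASCADE-THRESHOLD.md sha256
245123b9f388229f5703ee18f8f186a2cace4b21bfd44018154f82efe5904e10 (K8);
HOME/census/cascade/threshold_rate/{j338519,j338588,j338615}/table.md (K16/K16b/K16c); critic rows
54/58/62; node card HOME/decomp-ns-lens-4/NODE-g7.md sha256 bd379e18… (59 lines); probes
HOME/decomp-ns-lens-4/bc/ThresholdSaddleProbe.lean sha256 32cade2d… (+ .out 0a390c81…, .summary.txt:
CLEAN ×5 — PER ∃ε-form, PER ∀ε-form, W, W unfolded, NMT; P5 C → S never closed)).
- PER `ThresholdTangentPeriodicity` [crux r2 · NEW · DECLARED RESIDUAL · WEAKER than 1217 (vacuity)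
· S ⟹ PER · strictness UNDECIDED(T-saddle) · IDEA-NEEDED
  (closing lemma: extremality in critical norm + marginality ⟹ asymptotic periodicity of the
singularity; levers: threshold = codim-1 invariant set, recurrence
  theorem 1590, Gaussian-Floquet theory of DSS orbits being typed in tree) · INSTRUMENTABLE
(T-saddle: stage ratios of the principal-sheet threshold orbit →
  λ^{-1/2}, λ^{-2}?) · no catalogued barrier quantifies over a periodicity claim].
- W `TypeIDssWall` [crux r4 · DOOR · = tree `TypeIDSSLiouvilleConjecture` verbatim (dedup stmt-10721
/ ¬ stmt-0155) · WEAKER than 1217 (bridge 14478) and than S ·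
  CONJECTURED TRUE in print · ATTACKED CONJUNCT of record of this node · ATTACKABLE-PARTIAL: in-tree
rungs `GaussianGap.rdssClass_empty_of_typeI_le` (C₀ ≤ 8/25,
  all factors, all twists), `FixedTwistEmpty.rdssClass_fixedTwist_nearIdentity_ae_zero` (fine ratio
at fixed twist, Chae–Wolf Thm 1.3 in the mild class),
  `rdssClass_axisymmetric_empty` (BC5 witness), `rdssClass_pineauVicol_*`,
`rdssClass_subcriticalStrain_empty_unconditional`, `largeOrderTypeILiouville` ·
  BARRIER-placed (NearOneDssTypeIExclusion = its proved part; open top = coarse ratio, large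
constant)].
- NMT `LeanThresholdIsTypeI` [crux r3 · = N14 stmt-29108 verbatim · N14's declared residual (lineage
residual here) · MODEL-SEPARATED from M (K16b/c)].
- R `MarginalReduction` [support · stmt-25947 verbatim · PROVED (g2 lens) · in cone]. LBE
`LeanBadDatumExists` [support · N14 stmt-29109 verbatim · PROVED in the
  g6 lens (`exists_nearMinimal_bad` + `NearMinimal.mono`) · in cone].
- COSTUME: none (lens probe CLEAN ×5; writer BC7 re-probe of the booked decls attached; repair
census of the card: SS instead of DSS would be COSTUME — NSS is a
  THEOREM (Tsai 1998, tree `SelfSimilarExcluded` 8219) — hence DSS; the bare bridge «lean Type-I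
threshold ⟹ RDSS class nonempty» rejected as contentless).
LEAF TAGS. ATTACKABLE NOW: W's next rungs (coarse ratio at moderate constant; Pineau–Vicol windows),
LBE/R ports. IDEA-NEEDED: PER (closing lemma), NMT. INSTRUMENTABLE:
PER/NMT via T-saddle/T-lean (census requests in the card). BARRIER: W's open top
(NearOneDssTypeIExclusion locates it).

Rationale: WHY THIS LINE. Read the census literally: on every computed one-parameter family the blow-up
threshold is a SADDLE of the renormalisation (stage) map — a
scale-invariant cascade (e_n ∝ λ^{-n/2}, durations ∝ λ^{-2n}, |u|√(T−t) → 3.36, γ = 0.500) = a fixed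
point μ* of the stage map with exactly ONE unstable
multiplier (≈ 1.31 per level), the threshold being its codimension-one stable manifold (K8; K16b/c:
principal Type-I sheet on 34/40 rays, least-amplitude seeds on
it). A fixed point of a DISCRETE renormalisation step is, in physical variables, a DISCRETELY
SELF-SIMILAR space–time field — Choptuik's critical-collapse
dictionary (threshold = stable manifold of a DSS critical solution with one unstable mode; Choptuik
1993 PRL 70:9, Gundlach–Martín-García 2007 LRR 10:5). g7 types
the dictionary on the blocker of the N4/N14 lineage: the extremal (lean, marginal) Type-I
singularity has a tangent flow that is a PERIODIC ORBIT of the scaling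
flow (PER), and Tsai's Type-I DSS Liouville conjecture (W, the tree wall verbatim) empties that
class. W is the one piece of this lineage with a LADDER OF THEOREMS
already in the tree and a named open problem on top (Bradshaw–Tsai 2017 arXiv:1610.05680 §5 OP 5.1;
Tsai 2018 GSM 192 Conj. 8.8–8.9; Chae–Wolf 2017
arXiv:1610.09464 Thm 1.3). Imported: critical phenomena in gravitational collapse (explicit
dictionary: stage map ↦ renormalisation step, threshold ↦ critical
surface, μ* ↦ DSS critical solution, unstable multiplier ↦ Choptuik exponent), dynamical systems
(closing lemma / ω-limit of a codim-1 invariant set), DSS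
Navier–Stokes theory. Sources: HOME/decomp-ns-lens-4/ThresholdSaddle.lean sha256
2848ced3748364acfb5de9736fa564c7064a205b6e6e1ca57186d6bba9352676 (619 lines, lean rc 0 / 0 err / 0
warn / 0 sorry; axioms(closes) {propext, Classical.choice, Quot.sound});
HOME/decomp-ns-lens-4/NODE-g7.md sha256 bd379e18… (59 lines).
RANKED CRUXES. r2 PER `ThresholdTangentPeriodicity` (declared residual; hardest: no tool in print
turns norm-extremality + marginality into periodicity); r3 NMT
`LeanThresholdIsTypeI` (N14's residual, stmt-29108); r4 W `TypeIDssWall` (the door, attacked: six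
rungs in tree, BC5 witness `rdssClass_axisymmetric_empty`).
Supports in cone: R (stmt-25947, proved), LBE (stmt-29109, proved in lens).
KILL CRITERIA. PER refuted-substantive: a lean marginal Type-I threshold with no asymptotically
periodic vertex tangent flow (a quasi-periodic critical solution —
none known in any critical-collapse model). PER refuted-misstated risks: the SPACE–time decay
`HasTypeIDecay` of the tangent flow (deliberate: it is what the wall
needs and what every DSS profile with locally finite energy has, Bradshaw–Tsai 2017 Thm 1.2) and the
pointwise `IsTangentFlow` — repairs PER′ (time-Type-I + local
energy bound, door W′ = OP 5.1 in the local-Leray class) are pre-recorded in the card. W refuted ⟺ a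
nontrivial Type-I (R)DSS ancient mild solution exists ⟹
(bridge 14478) a Clay-class Type-I blow-up ⟹ ¬1217 and essentially ¬S: the summit falls, not just
the node. COLLAPSE: to N14 if PER is provable only through 1217
(vacuity); to N4 if NMT only through M.
NOT DECOMPOSED YET. PER beyond its plan-only BC3 skeleton (COMPACT: nontrivial mild vertex tangent
flow with the time-Type-I bound exists — KNSS/Seregin–Šverák
grade; ECHO: at a lean marginal threshold every such tangent flow is a Type-I RDSS orbit — the
closing lemma); W beyond its in-tree ladder (next rung: coarse ratio
λ ≥ λ₁ at moderate constant); the T-saddle instrument (stage-ratio convergence, Floquet count at μ*,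
spatial Type-I of the threshold orbit).
CHEAPEST FALSIFIER. T-saddle (1) on the census tables already computed (K8/K16b/c): do the last five
stage ratios e_{n+1}/e_n, τ_{n+1}/τ_n of the
principal-sheet threshold orbit converge to λ^{-1/2}, λ^{-2} (DSS fixed point) — or drift/scatter
(quasi-periodic: PER's model analogue dies)? For W: the next
rung attempt at fixed twist and coarse ratio is a Lean task on existing Gaussian-Floquet files; a
nontrivial numerical backward DSS Type-I profile (Hou 2022-type)
would flag W.

Novelty: Searches (lens-4 g7 2026-08-30, both corpora; re-read by the writer): `rg -il "choptuik|critical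
collapse|echoing" lean/Summits lean/Literature` → 0 files
under Summits/NavierStokesRegularity or Literature/Analysis/FluidPDE (hits only in other summits'
AnomalousDissipation/DyadicWallCascade, FinalStateConjecture,
CriticalPhenomena barrier files); `rg` IsRotatedDSS|IsDiscretelySelfSimilar × NearMinimal|minimal
blow|critical element|Kenig over NS Theses → 0; corpus
`lit search --hybrid "Choptuik critical collapse discrete self-similarity threshold one unstable
mode"` → physics only, nearest [corpus:ashtekar2015-general-
relativity-gravitation-centennial-perspective p.466] (Gundlach, critical collapse); `lit search
--hybrid "minimal blow-up data Navier-Stokes discretely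
self-similar singularity critical norm"` → [corpus:lemarie-rieusset2016 pp.771–779] (DSS solutions
chapter; no minimal-data × DSS statement), [corpus:seregin2014
p.174]; galaxy `"Choptuik scaling|critical collapse" --star all` → [galaxy:pdf:4861896740]
Baumgarte–Gundlach–Hilditch (GR only); `"discretely self-similar|minimal
blow-up data" --star pdf` → [galaxy:pdf:5756072837513326460] Bradshaw (forward DSS existence); no
hit joins NS minimal/threshold blow-up data with DSS tangent
flows in corpus(fts+vec) or galaxy. Tree: (i) RECURRENCE of Type-I profiles is a THEOREM
(`RecurrentProfiles.RecurrentReduction` stmt-1590, Birkhoff minimal set)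
with the door left at recurrent-Liouville (stmt-1589, no rungs beyond perio  [refs: 10.1137/120880197, 1610.05680, 1610.09464, doi:10.1137/120880197]

Barriers (technique_class: Choptuik-saddle echoing; leanest-threshold RDSS tangent): - technique_class: Choptuik-saddle echoing; leanest-threshold RDSS tangent (structure-vs-Liouville
split of the Type-I blocker at the extremal threshold: PER = periodic tangent flow, W = Type-I DSS
Liouville wall with an in-tree ladder)
- Literature.Barriers.NavierStokesRegularity.NearOneDssTypeIExclusion: W INSIDE by design — this
barrier IS the proved lower part of W's ladder (fine ratio
  λ < λ₁(C₀); in tree `FixedTwistEmpty.rdssClass_fixedTwist_nearIdentity_ae_zero`,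
[corpus:arxiv-1610.09464 p.2–4 Thm 1.3 / Rmk 1.4]) and LOCATES the open top:
  coarse ratio at large constant, no symmetry. PER is consistent with it: PER's tangent flow must
have c ≥ λ₁(C₀) and C₀ > 8/25 (lens `not_inTypeIRdssClass_of_smallConstant`;
  census K8 measures |u|√(T−t) ≈ 3.36, λ = 2).
- Literature.Barriers.NavierStokesRegularity.LeraySelfSimilarBlowupExclusion: OUTSIDE and respected
— exactly self-similar (c → 1⁺ / continuous) Type-I profiles
  are EXCLUDED (Nečas–Růžička–Šverák 1996, Tsai 1998; tree `SelfSimilarExcluded`), which is why PER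
asks for a DISCRETELY self-similar tangent flow (SS would be
  costume) and why W is open only for c bounded away from 1.
- Literature.Barriers.NavierStokesRegularity.AxisymmetricTypeIExclusion: a PROVED cell of both W
(`rdssClass_axisymmetric_empty`, BC5 witness) and 1217 (KNSS
  2009); PER/W make no axisymmetric assumption — a PER tangent flow must break continuous rotational
symmetry.
- Literature.Barriers.NavierStokesRegularity.EnergySupercriticality: NMT

sub-problem: NavierStokesRegularity · status: draft · opened planner-decomp-ns-writer-1-g3-0 2026-08-30T06:23:03Z · rev 2 · ledger route-NavierStokesRegularity-RootDecompThresholdSaddle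
GENERATED by the gate from the ledger (D-0016/17). Provers cite these decls: `theorem foo : Summit.NavierStokesRegularity.NavierStokesRegularity.Theses.RootDecompThresholdSaddle.<Decl> := …` in Summits/NavierStokesRegularity/NavierStokesRegularity/Theorems/<Name>.lean.
-/

namespace Summit.NavierStokesRegularity.NavierStokesRegularity.Theses.RootDecompThresholdSaddle

open scoped BigOperators Topology Manifold Classical MeasureTheory ProbabilityTheory Matrix InnerProductSpace ComplexConjugate ContinuousMap
open Filter Set Function TopologicalSpace MeasureTheory

attribute [summit_statement] _root_.NavierStokesRegularity

open Literature.NS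

/-- item stmt-NavierStokesRegularity-29251 · crux · rank 2 · open · by planner
why it might fail: The lean threshold's tangent flows could all be quasi-periodic / weakly mixing Type-I ancient flows (the «new regimes» of RecurrentLiouville 1589), or periodic without the SPACE–time Type-I decay the wall needs (only the time rate is inherited).
sources: arXiv:1610.05680, arXiv:1610.09464, Choptuik1993, GundlachMartinGarcia2007, SereginSverak2009, arXiv:1811.00502
[crux · PER · NEW · DECLARED RESIDUAL · WEAKER than 1217 = stmt-1217 (kernel
`periodicity_of_noTypeI`, vacuity) · S ⟹ PER · strictness vs 1217 UNDECIDED(T-saddle) · IDEA-NEEDED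
(closing lemma: recurrence ⟹ periodicity at an extremal threshold; recurrence is the tree THEOREM
RecurrentProfiles.RecurrentReduction stmt-1590) · INSTRUMENTABLE] THE LEAN TYPE-I THRESHOLD ECHOES:
there is ε > 0 such that for every ν > 0 and every maximal smooth Leray–Hopf solution (u, p) of
finite lifespan T from a rapidly decaying datum which is MARGINAL (Kato-global at every larger
viscosity), ε-LEAN (‖u 0‖₃ ≤ (1+ε)‖v‖₃ for every bad Clay datum v at ν) and blows up at the TYPE-I
rate, there are a point x₀, a factor c > 1, a linear isometry R and a vertex tangent flow U of u at
(T, x₀) (pointwise limit on s < 0 of the ν-normalised zooms lam_k • u (T + lam_k² ν s) (x₀ + lam_k ν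
y), lam_k → 0⁺) which is a NONTRIVIAL ancient mild (ν = 1) (c, R)-rotated discretely self-similar
solution with measurable slices and a Type-I space–time bound ‖U t x‖ ≤ C₀/(‖x‖ + √(−t)). -/
@[route_item "route-NavierStokesRegularity-RootDecompThresholdSaddle", crux]
def ThresholdTangentPeriodicity : Prop :=
  ∃ ε : ℝ, 0 < ε ∧ ∀ (ν T : ℝ), 0 < ν → 0 < T → ∀ (u : ℝ → EuclideanSpace ℝ (Fin 3) → EuclideanSpace ℝ (Fin 3)) (p : ℝ → EuclideanSpace ℝ (Fin 3) → ℝ), Literature.Analysis.FluidPDE.IsMaximalSmoothSolution ν 0 u p T → Literature.Analysis.FluidPDE.IsLerayHopfOn T ν 0 (u 0) u → Literature.Analysis.FluidPDE.HasRapidSpatialDecay (u 0) → (∀ ν' : ℝ, ν < ν' → Literature.Analysis.FluidPDE.HasGlobalKatoSolution ν' (u 0)) → (∀ v : EuclideanSpace ℝ (Fin 3) → EuclideanSpace ℝ (Fin 3), (ContDiff ℝ (⊤ : ℕ∞) v ∧ Literature.Analysis.FluidPDE.NSWave0.IsDivFree v ∧ Literature.Analysis.FluidPDE.HasRapidSpatialDecay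 v) → ¬ Literature.Analysis.FluidPDE.HasGlobalKatoSolution ν v → eLpNorm (u 0) 3 volume ≤ ENNReal.ofReal (1 + ε) * eLpNorm v 3 volume) → Literature.Analysis.FluidPDE.IsTypeIBlowup u T → ∃ (x₀ : EuclideanSpace ℝ (Fin 3)) (U : ℝ → EuclideanSpace ℝ (Fin 3) → EuclideanSpace ℝ (Fin 3)) (c : ℝ) (R : EuclideanSpace ℝ (Fin 3) ≃ₗᵢ[ℝ] EuclideanSpace ℝ (Fin 3)), (∃ lam : ℕ → ℝ, (∀ k : ℕ, 0 < lam k) ∧ Tendsto lam atTop (𝓝 0) ∧ ∀ s : ℝ, s < 0 → ∀ y : EuclideanSpace ℝ (Fin 3), Tendsto (fun k : ℕ => lam k • u (T + lam k ^ 2 * ν * s) (x₀ + (lam k * ν) • y)) atTop (𝓝 (U s y))) ∧ (1 < c ∧ Literature.Analysis.FluidPDE.IsAncientMildSolution 1 U ∧ (∀ t : ℝ, t < 0 → AEStronglyMeasurable (U t) volume) ∧ Literature.Analysis.FluidPDE.IsRotatedDSS c R U ∧ (∃ C₀ : ℝ, Literature.Analysis.FluidPDE.HasTypeIDecay C₀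 U) ∧ ¬ (∀ t : ℝ, t < 0 → U t =ᵐ[volume] 0))

/-- item stmt-NavierStokesRegularity-29108 · crux · rank 3 · open · by planner
why it might fail: The leanest bad datum of a robust scenario may be a two-scale driver–payload pair blowing up at a Type-II rate; no monotonicity identity turning near-minimality into a RATE is known for NS (Tao 2007 §8).
sources: doi:10.1137/120880197, arXiv:1012.0145, doi:10.1016/j.jfa.2010.09.009, KenigMerle2006, arXiv:math/0608293
[crux · NMT · DECLARED RESIDUAL (the only new one) · WEAKER than M = stmt-25946 (restriction to
ε-near-minimal data) · S ⟹ NMT · MODEL-SEPARATED from M (census K16b/K16c) · IDEA-NEEDED (Type-I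
rigidity of near-minimal elements) · INSTRUMENTABLE (T-lean)] THE LEANEST MARGINAL BLOW-UP IS TYPE
I: there is ε > 0 such that every marginal (Kato-global at all larger viscosities) maximal smooth
Leray–Hopf solution of finite lifespan T from a rapidly decaying datum whose L³ norm is within the
factor 1+ε of the L³ norm of EVERY bad Clay datum at its viscosity (smooth, div-free, rapidly
decaying, no global Kato solution) blows up at the Type-I rate at T. Layer 2 (plan-only, BC3
skeleton): NMT ⟸ LINK (lean ⟹ near the Jia–Šverák minimal compactum) ∧ RIGID (near-compactum
marginal blow-up is Type I). -/
@[route_item "route-NavierStokesRegularity-RootDecompThresholdSaddle", crux]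
def LeanThresholdIsTypeI : Prop :=
  ∃ ε : ℝ, 0 < ε ∧ ∀ (ν T : ℝ), 0 < ν → 0 < T → ∀ (u : ℝ → EuclideanSpace ℝ (Fin 3) → EuclideanSpace ℝ (Fin 3)) (p : ℝ → EuclideanSpace ℝ (Fin 3) → ℝ), Literature.Analysis.FluidPDE.IsMaximalSmoothSolution ν 0 u p T → Literature.Analysis.FluidPDE.IsLerayHopfOn T ν 0 (u 0) u → Literature.Analysis.FluidPDE.HasRapidSpatialDecay (u 0) → (∀ ν' : ℝ, ν < ν' → Literature.Analysis.FluidPDE.HasGlobalKatoSolution ν' (u 0)) → (∀ v : EuclideanSpace ℝ (Fin 3) → EuclideanSpace ℝ (Fin 3), (ContDiff ℝ (⊤ : ℕ∞) v ∧ Literature.Analysis.FluidPDE.NSWave0.IsDivFree v ∧ Literature.Analysis.FluidPDE.HasRapidSpatialDecay v) → ¬ Literature.Analysis.FluidPDE.HasGlobalKatoSolution ν v → eLpNorm (u 0) 3 volume ≤ ENNReal.ofReal (1 + ε) * eLpNorm v 3 volume) → Literature.Analysis.FluidPDE.IsTypeIBlowup u T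

/-- item stmt-NavierStokesRegularity-29252 · crux · rank 4 · SPLIT (gen 1) into SmallEnvelopeDssLiouville, FineRatioLargeEnvelopeDssLiouville, CoarseRatioLargeEnvelopeDssLiouville + glue TypeIDssWall_of_cells · direct attempts still welcome (low priority) · by planner
why it might fail: A nontrivial backward λ-DSS Type-I profile with λ ≫ 1 may exist (forward DSS solutions exist for every λ, tree `chae_wolf_dss_existence`; Hou's 2022 nearly self-similar numerics); W is Bradshaw–Tsai OP 5.1, open.
sources: arXiv:1610.05680, Tsai2018, arXiv:1610.09464, NecasRuzickaSverak1996, Tsai1998, SereginSverak2009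
[crux · W · THE DOOR · = tree `Literature.Analysis.FluidPDE.TypeIDSSLiouvilleConjecture` VERBATIM (=
¬ stmt-0155 BlowupTypeIDssProfile; = Blowup.TypeIDssLiouville stmt-10721, re-attached) · WEAKER than
1217 (kernel `wall_of_noTypeI` via the PROVED bridge dssTruncationBridgeTypeI_proof stmt-14478) and
than S (`wall_of_root`) · CONJECTURED TRUE (Tsai GSM 192 Conj. 8.8–8.9) · ATTACKED CONJUNCT of
record · ATTACKABLE-PARTIAL: in-tree rungs GaussianGap.rdssClass_empty_of_typeI_le (C₀ ≤ 8/25),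
FixedTwistEmpty.rdssClass_fixedTwist_nearIdentity_ae_zero (Chae–Wolf Thm 1.3),
rdssClass_axisymmetric_empty (BC5 witness), rdssClass_pineauVicol_*,
rdssClass_subcriticalStrain_empty_unconditional, largeOrderTypeILiouville · OPEN TOP: coarse ratio
at large constant, no symmetry] TSAI'S TYPE-I DSS WALL: for every factor c, the plain and every
rotated Type-I c-DSS Liouville statement hold — every ancient mild solution (ν = 1) with measurable
slices which is (rotated) c-DSS, c > 1, and Type-I bounded ‖u t x‖ ≤ C₀/(‖x‖ + √(−t)) has
a.e.-vanishing slices. -/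
@[route_item "route-NavierStokesRegularity-RootDecompThresholdSaddle", crux]
def TypeIDssWall : Prop :=
  ∀ c : ℝ, Literature.Analysis.FluidPDE.TypeIDSSLiouville c ∧ ∀ R : EuclideanSpace ℝ (Fin 3) ≃ₗᵢ[ℝ] EuclideanSpace ℝ (Fin 3), Literature.Analysis.FluidPDE.RotatedTypeIDSSLiouville c R

-- parent: TypeIDssWall · child (gen 1)
/--     item stmt-NavierStokesRegularity-31464 · crux · rank 401 · open
    parent: TypeIDssWall · by planner
    why it might fail: A Type-I RDSS ancient profile with envelope ≤ 3 may exist: model K8 threshold orbits have envelope ≥ 6.5 (room above 3) but no sharpness for 1024/27 is known, and every proved window is DSS-blind — it cannot pass the true minimal envelope.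
    sources: arXiv:1610.09464, arXiv:2607.09619, Tsai2018LecturesNS, KochNadirashviliSereginSverak2009
[crux · T «WINDOW(3)» · NEW · child 1 of the GLUED SPLIT (gen 1) of W `TypeIDssWall`
stmt-NavierStokesRegularity-29252 (N15 crux r4 ATTACKED = tree TypeIDSSLiouvilleConjecture verbatim;
shared with N18) = lens-1 g7 «THE DSS ENVELOPE LADDER» (HOME/decomp-ns-lens-1/DssEnvelopeLadder.lean
sha256 dc9c3699…, 440 lines, lean rc 0 / 0 err / 0 warn / 0 sorry, axioms std; NODE-g7.md cd9714a7…;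
CRITIC-LEDGER row 87 CLEARED 2026-08-30T07:53:24Z): W ⟺ T ∧ F ∧ C EXACT in kernel (`wall_iff_pieces`
= instance (K, Λ) = (3, 2) of the parametrised ladder `wall_iff_cells K Λ`, via tree
`ScenarioCensus.rdssClassEmpty_forall_iff_conjecture`); DIAL 1 = ENVELOPE K (least Type-I constant),
DIAL 2 = MINIMAL DSS FACTOR (the NearOneDssTypeIExclusion «non-minimal factor» caveat honoured: C
quantifies over ALL factors, F over SOME factor ≤ 2). Why novel: the first node that CUTS W, along
the two dials in which the in-tree rungs (K) and the one DSS-aware theorem (c) are stated; every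
proved window is DSS-BLIND, so the ladder's ceiling-lift is THE FIRST USE OF THE PERIOD. census
COSTUME-CENSUS-v5 sha256 df8a129f… (T-dss-1 DSS envelope dial = census K26, running, bus L340). BC7
lens probe T/F/C/B 4/4 CLEAN (bc/Ds -/
@[route_item "route-NavierStokesRegularity-RootDecompThresholdSaddle"]
def SmallEnvelopeDssLiouville : Prop :=
  ∀ (c : ℝ) (R : EuclideanSpace ℝ (Fin 3) ≃ₗᵢ[ℝ] EuclideanSpace ℝ (Fin 3)) (u : ℝ → EuclideanSpace ℝ (Fin 3) → EuclideanSpace ℝ (Fin 3)), 1 < c → Literature.Analysis.FluidPDE.IsAncientMildSolution 1 u → (∀ t : ℝ, t < 0 → AEStronglyMeasurable (u t) volume) → Literature.Analysis.FluidPDE.IsRotatedDSS c R u → Literature.Analysis.FluidPDE.HasTypeIDecay 3 u → ∀ t : ℝ, t < 0 → u t =ᵐ[volume] 0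

-- parent: TypeIDssWall · child (gen 1)
/--     item stmt-NavierStokesRegularity-31465 · crux · rank 402 · open
    parent: TypeIDssWall · by planner
    why it might fail: as typed F ⟸ C 31466 (coarse_iff_coarse_and_fine), so F is not load-bearing in the gen-1 kill path T → F → C → W; it is again in the repaired split T ∧ F ∧ C^R ∧ REG; a Type-I DSS profile with factor ≤ 2 and envelope > 3 refutes it.
    sources: arXiv:1610.05680, arXiv:1610.09464, arXiv:2607.09619
[crux · F «FINE RATIO, LARGE ENVELOPE» · NEW · child 2 of the GLUED SPLIT (gen 1) of W
`TypeIDssWall` stmt-NavierStokesRegularity-29252 (N15 crux r4 ATTACKED = tree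
TypeIDSSLiouvilleConjecture verbatim; shared with N18) = lens-1 g7 «THE DSS ENVELOPE LADDER»
(HOME/decomp-ns-lens-1/DssEnvelopeLadder.lean sha256 dc9c3699…, 440 lines, lean rc 0 / 0 err / 0
warn / 0 sorry, axioms std; NODE-g7.md cd9714a7…; CRITIC-LEDGER row 87 CLEARED
2026-08-30T07:53:24Z): W ⟺ T ∧ F ∧ C EXACT in kernel (`wall_iff_pieces` = instance (K, Λ) = (3, 2)
of the parametrised ladder `wall_iff_cells K Λ`, via tree
`ScenarioCensus.rdssClassEmpty_forall_iff_conjecture`); DIAL 1 = ENVELOPE K (least Type-I constant),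
DIAL 2 = MINIMAL DSS FACTOR (the NearOneDssTypeIExclusion «non-minimal factor» caveat honoured: C
quantifies over ALL factors, F over SOME factor ≤ 2). Why novel: the first node that CUTS W, along
the two dials in which the in-tree rungs (K) and the one DSS-aware theorem (c) are stated; every
proved window is DSS-BLIND, so the ladder's ceiling-lift is THE FIRST USE OF THE PERIOD. census
COSTUME-CENSUS-v5 sha256 df8a129f… (T-dss-1 DSS envelope dial = census K26, running, bus L340). BC7
lens probe T/F/C/B -/
@[route_item "route-NavierStokesRegularity-RootDecompThresholdSaddle"]
def FineRatioLargeEnvelopeDssLiouville : Prop :=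
  ∀ (c : ℝ) (R : EuclideanSpace ℝ (Fin 3) ≃ₗᵢ[ℝ] EuclideanSpace ℝ (Fin 3)) (u : ℝ → EuclideanSpace ℝ (Fin 3) → EuclideanSpace ℝ (Fin 3)), 1 < c → c ≤ 2 → Literature.Analysis.FluidPDE.IsAncientMildSolution 1 u → (∀ t : ℝ, t < 0 → AEStronglyMeasurable (u t) volume) → Literature.Analysis.FluidPDE.IsRotatedDSS c R u → (∃ C₀ : ℝ, Literature.Analysis.FluidPDE.HasTypeIDecay C₀ u) → ¬ Literature.Analysis.FluidPDE.HasTypeIDecay 3 u → ∀ t : ℝ, t < 0 → u t =ᵐ[volume] 0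

-- parent: TypeIDssWall · child (gen 1)
/--     item stmt-NavierStokesRegularity-31466 · crux · rank 403 · open
    parent: TypeIDssWall · by planner
    why it might fail: CERTIFIED (critic row 208): as typed C swallows F 31465 — a junk slice on t ≥ 0 kills every factor ≤ 2 (coarse_iff_coarse_and_fine), so the ratio dial is void (W ⟺ T ∧ C); still WEAKER than W; repaired cell = C^R 27776; a large-factor Type-I λ-DSS profile refutes it.
    sources: arXiv:1610.05680, arXiv:1610.09464, arXiv:0709.3599
[crux · C «COARSE RATIO, LARGE ENVELOPE» · NEW · child 3 of the GLUED SPLIT (gen 1) of W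
`TypeIDssWall` stmt-NavierStokesRegularity-29252 (N15 crux r4 ATTACKED = tree
TypeIDSSLiouvilleConjecture verbatim; shared with N18) = lens-1 g7 «THE DSS ENVELOPE LADDER»
(HOME/decomp-ns-lens-1/DssEnvelopeLadder.lean sha256 dc9c3699…, 440 lines, lean rc 0 / 0 err / 0
warn / 0 sorry, axioms std; NODE-g7.md cd9714a7…; CRITIC-LEDGER row 87 CLEARED
2026-08-30T07:53:24Z): W ⟺ T ∧ F ∧ C EXACT in kernel (`wall_iff_pieces` = instance (K, Λ) = (3, 2)
of the parametrised ladder `wall_iff_cells K Λ`, via tree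
`ScenarioCensus.rdssClassEmpty_forall_iff_conjecture`); DIAL 1 = ENVELOPE K (least Type-I constant),
DIAL 2 = MINIMAL DSS FACTOR (the NearOneDssTypeIExclusion «non-minimal factor» caveat honoured: C
quantifies over ALL factors, F over SOME factor ≤ 2). Why novel: the first node that CUTS W, along
the two dials in which the in-tree rungs (K) and the one DSS-aware theorem (c) are stated; every
proved window is DSS-BLIND, so the ladder's ceiling-lift is THE FIRST USE OF THE PERIOD. census
COSTUME-CENSUS-v5 sha256 df8a129f… (T-dss-1 DSS envelope dial = census K26, running, bus L340). BC7
lens probe T/F/C -/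
@[route_item "route-NavierStokesRegularity-RootDecompThresholdSaddle"]
def CoarseRatioLargeEnvelopeDssLiouville : Prop :=
  ∀ (c : ℝ) (R : EuclideanSpace ℝ (Fin 3) ≃ₗᵢ[ℝ] EuclideanSpace ℝ (Fin 3)) (u : ℝ → EuclideanSpace ℝ (Fin 3) → EuclideanSpace ℝ (Fin 3)), 1 < c → Literature.Analysis.FluidPDE.IsAncientMildSolution 1 u → (∀ t : ℝ, t < 0 → AEStronglyMeasurable (u t) volume) → Literature.Analysis.FluidPDE.IsRotatedDSS c R u → (∀ (c' : ℝ) (R' : EuclideanSpace ℝ (Fin 3) ≃ₗᵢ[ℝ] EuclideanSpace ℝ (Fin 3)), 1 < c' → c' ≤ 2 → ¬ Literature.Analysis.FluidPDE.IsRotatedDSS c' R' u) → (∃ C₀ : ℝ, Literature.Analysis.FluidPDE.HasTypeIDecay C₀ u) → ¬ Literature.Analysis.FluidPDE.HasTypeIDecay 3 u → ∀ t : ℝ, t < 0 → u t =ᵐ[volume] 0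

-- parent: TypeIDssWall · glue (gen 1)
/--     item stmt-NavierStokesRegularity-31467 · support · rank 404 · closed · proved by Summit.NavierStokesRegularity.NavierStokesRegularity.Theorems.RootDecompThresholdSaddleWallOfCells.typeIDssWall_of_cells_holds (planner)
    parent: TypeIDssWall · GLUE: children ⟹ parent · by planner
lens-1 g7 «THE DSS ENVELOPE LADDER» (CRITIC-LEDGER row 87 CLEARED 2026-08-30T07:53Z;
HOME/decomp-ns-lens-1/DssEnvelopeLadder.lean sha256 dc9c3699…, rc 0 / 0 sorry): W TypeIDssWall
(29252) ⟺ T ∧ F ∧ C EXACT in kernel (wall_iff_pieces = instance (K,Λ)=(3,2) of wall_iff_cells via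
ScenarioCensus.rdssClassEmpty_forall_iff_conjecture); dial 1 = Type-I envelope constant K (cut at 3;
in-tree floor K⁴<1024/27), dial 2 = minimal DSS factor (cut at 2). T = SmallEnvelopeDssLiouville
ATTACKED (incremental, instrumented T-dss-1), F = FineRatioLargeEnvelopeDssLiouville IDEA-NEEDED
(ceiling-lift: first use of the period), C = CoarseRatioLargeEnvelopeDssLiouville DECLARED RESIDUAL
(Bradshaw–Tsai OP 5.1 / KNSS end). Glue T → F → C → W is by_cases on HasTypeIDecay 3 u and on ∃
factor ≤ 2 (proof attached as evidence GlueProofW.lean). -/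
@[route_item "route-NavierStokesRegularity-RootDecompThresholdSaddle"]
def TypeIDssWall_of_cells : Prop :=
  SmallEnvelopeDssLiouville → FineRatioLargeEnvelopeDssLiouville → CoarseRatioLargeEnvelopeDssLiouville → TypeIDssWall

-- `TypeIDssWall_of_cells` holds: proved by `Summit.NavierStokesRegularity.NavierStokesRegularity.Theorems.RootDecompThresholdSaddleWallOfCells.typeIDssWall_of_cells_holds` (its module imports this route file, so no `_holds` link can be stated here).

/-- item stmt-NavierStokesRegularity-25947 · support · rank 9 · closed · proved by Summit.NavierStokesRegularity.NavierStokesRegularity.Theorems.MarginalReduction.marginalReduction_proof (planner) · by planner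
why it might fail: it does not — kernel-proved in the g2 lens file against the tree; only the port can stall on import drift
sources: Kato1984, LemarieRieusset2016, arXiv:1012.0145
[support] THE REDUCTION (R) — PROVED in the lens file (`marginalReduction_holds`, ≈ 200 lines:
stmt-1750 `Theorems.marginalTypeI_criticalViscosityExists_proof` (Kato small data + GIP 2003
openness + viscosity scaling) + the Kato → maximal smooth Leray–Hopf bookkeeping of the proved frame
item 0055 re-run at νc, `exists_isMaximalSmoothSolution_of_not_hasGlobalKatoSolution`) [tag support
· PROVABLE NOW — FIRST PROVER TARGET: port the lens proof verbatim into Theorems/ (imports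
TypeICertificateLadderNoBlowupToClay, MarginalTypeICriticalViscosityExists, BlowupAssembly,
KatoViscosityScaling) · load-bearing binder of `closes`] if a Clay datum u₀ (smooth,
divergence-free, rapidly decaying) has no global Kato solution at viscosity ν > 0, then there is a
critical viscosity νc ≥ ν such that u₀ is Kato-global at every ν' > νc and, at νc, launches a
maximal smooth solution (u, p) of finite lifespan T > 0, Leray–Hopf on [0,T] from u₀, with u 0 = u₀.
[difficulty: provable-now] -/
@[route_item "route-NavierStokesRegularity-RootDecompThresholdSaddle", crux]
def MarginalReduction : Prop :=
  ∀ ν : ℝ, 0 < ν → ∀ u₀ : EuclideanSpace ℝ (Fin 3) → EuclideanSpace ℝ (Fin 3), ContDiff ℝ (⊤ : ℕ∞) u₀ → Literature.Analysis.FluidPDE.NSWave0.IsDivFree u₀ → Literature.Analysis.FluidPDE.HasRapidSpatialDecay u₀ → ¬ Literature.Analysis.FluidPDE.HasGlobalKatoSolution ν u₀ → ∃ νc : ℝ, ν ≤ νc ∧ (∀ ν' : ℝ, νc < ν' → Literature.Analysis.FluidPDE.HasGlobalKatoSolution ν' u₀) ∧ ∃ T : ℝ, 0 < T ∧ ∃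 (u : ℝ → EuclideanSpace ℝ (Fin 3) → EuclideanSpace ℝ (Fin 3)) (p : ℝ → EuclideanSpace ℝ (Fin 3) → ℝ), Literature.Analysis.FluidPDE.IsMaximalSmoothSolution νc 0 u p T ∧ Literature.Analysis.FluidPDE.IsLerayHopfOn T νc 0 u₀ u ∧ u 0 = u₀

/-- `MarginalReduction` holds: proved by `Summit.NavierStokesRegularity.NavierStokesRegularity.Theorems.MarginalReduction.marginalReduction_proof`. -/
theorem MarginalReduction_holds : MarginalReduction := _root_.Summit.NavierStokesRegularity.NavierStokesRegularity.Theorems.MarginalReduction.marginalReduction_proof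

/-- item stmt-NavierStokesRegularity-27745 · aside · rank 9 · closed · proved by Summit.NavierStokesRegularity.NavierStokesRegularity.Theorems.RootDecompFactorLadderRepresentative.typeIRdssRepresentative_holds (planner) · by planner
[support] REG «CLASSICAL PINNED REPRESENTATIVE» (lens-1 g17 FAKE BREATHER repair kit, critic row
208: EXPECTED THEOREM, ATTACKABLE NOW, first prover target of N26 rev 3; load-bearing binder of the
repaired closes (hK hREG hA hBR)): every member of W's class (ancient mild ν = 1 in duality form,
measurable slices on t < 0, (c,R)-rotated-DSS with c > 1, Type-I envelope) is slice-wise a.e. on the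
past equal to a member V of the SAME class which is jointly continuous on the open past and vanishes
on t ≥ 0, with the same (c,R)-RDSS symmetry. Route to a proof: Type-I ⟹ bounded on every (−∞, −δ);
bounded ancient mild solutions are smooth on the past (KNSS 2009 §4, Rem. 4.1 / §6;
Fabes–Jones–Rivière 1972 Thm 2.1, tree classical_of_smooth_isMildNSSolutionOn_holds pattern of
TypeIAncientMildClassical.lean); pass the RDSS identity to the continuous representative by
Continuous.ae_eq_iff_eq, the Type-I bound by continuity, the class by past-only congruence
(isAncientMildSolution_congr), cut off at t ≥ 0 (isRotatedDSS_of_Iio_of_eq_zero). CONSISTENT: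
implied by W 29252 with V := 0 (writer Sketch reg_of_wall). Why it might fail: only through the
Bochner-junk reading of IsAncientMildSolution (slice -/
@[route_item "route-NavierStokesRegularity-RootDecompThresholdSaddle"]
def TypeIRdssRepresentative : Prop :=
  ∀ (c : ℝ) (R : EuclideanSpace ℝ (Fin 3) ≃ₗᵢ[ℝ] EuclideanSpace ℝ (Fin 3)) (u : ℝ → EuclideanSpace ℝ (Fin 3) → EuclideanSpace ℝ (Fin 3)), 1 < c → Literature.Analysis.FluidPDE.IsAncientMildSolution 1 u → (∀ t : ℝ, t < 0 → MeasureTheory.AEStronglyMeasurable (u t) MeasureTheory.volume) → Literature.Analysis.FluidPDE.IsRotatedDSS c R u → (∃ C₀ : ℝ, Literature.Analysis.FluidPDE.HasTypeIDecay C₀ u) → ∃ V : ℝ → EuclideanSpace ℝ (Fin 3) → EuclideanSpace ℝ (Fin 3), (∀ t : ℝ, t < 0 → V t =ᵐ[MeasureTheory.volume] u t) ∧ Literature.Analysis.FluidPDE.IsAncientMildSolution 1 V ∧ (∀ t : ℝ, t < 0 → MeasureTheory.AEStronglyMeasurable (V t) MeasureTheory.volume) ∧ ContinuousOn (Function.uncurry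 V) (Set.Iio 0 ×ˢ Set.univ) ∧ (∀ t : ℝ, 0 ≤ t → V t = 0) ∧ Literature.Analysis.FluidPDE.IsRotatedDSS c R V ∧ ∃ C₀ : ℝ, Literature.Analysis.FluidPDE.HasTypeIDecay C₀ V

-- `TypeIRdssRepresentative` holds: proved by `Summit.NavierStokesRegularity.NavierStokesRegularity.Theorems.RootDecompFactorLadderRepresentative.typeIRdssRepresentative_holds` (its module imports this route file, so no `_holds` link can be stated here).

/-- item stmt-NavierStokesRegularity-29109 · support · rank 9 · closed · proved by Summit.NavierStokesRegularity.NavierStokesRegularity.Theorems.LeanBadDatumExists.leanBadDatumExists_proof (planner) · by planner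
why it might fail: it does not as mathematics (kernel-proved in the lens file); typing risk only: ENNReal/eLpNorm order vacuous if the threshold were 0 or ⊤ — both excluded in the lens proof
sources: Kato1984, LemarieRieusset2016, doi:10.1137/120880197
[support · LBE · PROVED in the lens file (§4 `exists_nearMinimal_bad` + `NearMinimal.mono`, ≈ 90
lines over the tree's `exists_kato_threshold` and `hasGlobalKatoSolution_smul_iff`; port = copy into
Theorems/) · in cone · barrier-free] LEAN BAD DATA EXIST AND STAY LEAN UP THE VISCOSITY RAY: for
every ε > 0, ν > 0 and every bad Clay datum u₀ at ν there is a bad Clay datum w at ν with ‖w‖₃ ≤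
(1+ε)‖v‖₃ for every bad Clay datum v at every viscosity ν' ≥ ν (threshold positive by Kato, finite
since u₀ ∈ L³; leanness climbs in ν by the amplitude–viscosity scaling). -/
@[route_item "route-NavierStokesRegularity-RootDecompThresholdSaddle", crux]
def LeanBadDatumExists : Prop :=
  ∀ ε : ℝ, 0 < ε → ∀ ν : ℝ, 0 < ν → ∀ u₀ : EuclideanSpace ℝ (Fin 3) → EuclideanSpace ℝ (Fin 3), (ContDiff ℝ (⊤ : ℕ∞) u₀ ∧ Literature.Analysis.FluidPDE.NSWave0.IsDivFree u₀ ∧ Literature.Analysis.FluidPDE.HasRapidSpatialDecay u₀) → ¬ Literature.Analysis.FluidPDE.HasGlobalKatoSolution ν u₀ → ∃ w : EuclideanSpace ℝ (Fin 3) → EuclideanSpace ℝ (Fin 3), (ContDiff ℝ (⊤ : ℕ∞) w ∧ Literature.Analysis.FluidPDE.NSWave0.IsDivFree w ∧ Literature.Analysis.FluidPDE.HasRapidSpatialDecay w) ∧ ¬ Literature.Analysis.FluidPDE.HasGlobalKatoSolution ν w ∧ ∀ ν' : ℝ, ν ≤ ν' → (∀ v : EuclideanSpace ℝ (Fin 3)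 → EuclideanSpace ℝ (Fin 3), (ContDiff ℝ (⊤ : ℕ∞) v ∧ Literature.Analysis.FluidPDE.NSWave0.IsDivFree v ∧ Literature.Analysis.FluidPDE.HasRapidSpatialDecay v) → ¬ Literature.Analysis.FluidPDE.HasGlobalKatoSolution ν' v → eLpNorm w 3 volume ≤ ENNReal.ofReal (1 + ε) * eLpNorm v 3 volume)

-- `LeanBadDatumExists` holds: proved by `Summit.NavierStokesRegularity.NavierStokesRegularity.Theorems.LeanBadDatumExists.leanBadDatumExists_proof` (its module imports this route file, so no `_holds` link can be stated here).

/-- item stmt-NavierStokesRegularity-27776 · aside · rank 405 · open · by planner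
why it might fail: the coarse-ratio large-envelope cell is the habitat of a genuine Type-I λ-DSS backward profile with λ > 2 (Bradshaw–Tsai build λ-DSS forward for every λ > 1; no Liouville theorem above the near-identity gap, Chae–Wolf Thm 1.3 needs λ − 1 small); pinned and past-continuous, it refutes C^R.
sources: arXiv:1610.05680, arXiv:1610.09464, arXiv:0709.3599, arXiv:2607.09619
[crux] C^R «PAST COARSE-RATIO LARGE-ENVELOPE DSS LIOUVILLE» (lens-1 g17 FAKE BREATHER repair kit §3,
critic row 208 booking «N15 C^R»; repaired C 31466 — BANKED for the tenure resplit of W 29252 into T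
31464 ∧ F 31465 ∧ C^R ∧ REG 27745, runbook HOME/TREE.md §N15): every ancient mild solution (ν = 1,
duality form) with measurable slices on t < 0 which is JOINTLY CONTINUOUS on the open past, PINNED
(u = 0 on t ≥ 0), (c,R)-rotated-DSS for some c > 1 and R ∈ O(3), admits NO rotated-DSS factor in
(1,2] (so c > 2: COARSE RATIO — and pinning makes this a statement about the past,
`isRotatedDSS_of_Iio_of_eq_zero`), is Type-I but NOT with envelope constant 3 (LARGE ENVELOPE), has
a.e.-vanishing past slices. As typed C 31466 swallowed F 31465 (junk extension on t ≥ 0 kills every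
factor ≤ 2: certificate `coarse_iff_coarse_and_fine`, W ⟺ T ∧ C); the two new binders block the junk
extension, so C^R is the honest coarse cell: WEAKER than W (drop binders), DECLARED RESIDUAL of the
W lineage (never a prover target), W ⟺ T ∧ F ∧ C^R modulo REG (certificate
`wall_iff_repaired_cells`). Why it might fail: the coarse-ratio large-envelope cell is exactly the
habitat of a genuine Type-I λ-DSS backward pr -/
@[route_item "route-NavierStokesRegularity-RootDecompThresholdSaddle"]
def PastCoarseRatioLargeEnvelopeDssLiouville : Prop :=
  ∀ (c : ℝ) (R : EuclideanSpace ℝ (Fin 3) ≃ₗᵢ[ℝ] EuclideanSpace ℝ (Fin 3)) (u : ℝ → EuclideanSpace ℝ (Fin 3) → EuclideanSpace ℝ (Fin 3)), 1 < c → Literature.Analysis.FluidPDE.IsAncientMildSolution 1 u → (∀ t : ℝ, t < 0 → MeasureTheory.AEStronglyMeasurable (u t) MeasureTheory.volume) → ContinuousOn (Function.uncurry u) (Set.Iio 0 ×ˢ Set.univ) → (∀ t : ℝ, 0 ≤ t → u t = 0) → Literature.Analysis.FluidPDE.IsRotatedDSS c R u → (∀ (c' : ℝ) (R' : EuclideanSpace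 ℝ (Fin 3) ≃ₗᵢ[ℝ] EuclideanSpace ℝ (Fin 3)), 1 < c' → c' ≤ 2 → ¬ Literature.Analysis.FluidPDE.IsRotatedDSS c' R' u) → (∃ C₀ : ℝ, Literature.Analysis.FluidPDE.HasTypeIDecay C₀ u) → ¬ Literature.Analysis.FluidPDE.HasTypeIDecay 3 u → ∀ t : ℝ, t < 0 → u t =ᵐ[MeasureTheory.volume] 0

/-- item stmt-NavierStokesRegularity-29253 · assembly · rank 1 · open · by planner
Clay (A) from R, LBE, NMT, PER, W: Kato-global data get Clay solutions (landed
`clay_solution_of_hasGlobalKatoSolution_holds`); a bad datum has a lean bad companion (LBE) whose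
marginal blow-up (R) is Type I (NMT), hence has a nontrivial Type-I RDSS vertex tangent flow (PER),
which the wall (W) says is trivial — contradiction (deciding theorem closes, verbatim the lens
kernel). -/
@[route_item "route-NavierStokesRegularity-RootDecompThresholdSaddle"]
def Assembly : Prop :=
  MarginalReduction → LeanBadDatumExists → LeanThresholdIsTypeI → ThresholdTangentPeriodicity → TypeIDssWall → NavierStokesRegularity

/-! D-0027 §2.1 — DECIDING THEOREM (planner-authored via `route open/edit --closes-file`; by planner-decomp-ns-writer-1-g3-0 2026-08-30T06:23:03Z):
its hypotheses are this route's items and its conclusion the sub-problem Statement (glue_lint), and it elaborates with this file. -/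

@[closes "route-NavierStokesRegularity-RootDecompThresholdSaddle"] theorem closes (hR : MarginalReduction) (hX : LeanBadDatumExists) (hL : LeanThresholdIsTypeI)
    (hP : ThresholdTangentPeriodicity) (hW : TypeIDssWall) : NavierStokesRegularity := by
  intro ν hν u₀ hsm hdiv hdec
  by_cases hK : Literature.Analysis.FluidPDE.HasGlobalKatoSolution ν u₀
  · exact Literature.Analysis.FluidPDE.clay_solution_of_hasGlobalKatoSolution_holds ν hν u₀ hsm hdiv hdec hK
  exfalso
  obtain ⟨ε₁, hε₁, hlean⟩ := hL
  obtain ⟨ε₂, hε₂, hper⟩ := hP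
  obtain ⟨w, hw, hKw, hmin⟩ := hX (min ε₁ ε₂) (lt_min hε₁ hε₂) ν hν u₀ ⟨hsm, hdiv, hdec⟩ hK
  obtain ⟨νc, hνc, hglob, T, hT, u, p, hmax, hLH, hu0⟩ := hR ν hν w hw.1 hw.2.1 hw.2.2 hKw
  have hνc0 : 0 < νc := lt_of_lt_of_le hν hνc
  subst hu0
  have hle : ∀ {ε : ℝ} {a b : ENNReal}, min ε₁ ε₂ ≤ ε → a ≤ ENNReal.ofReal (1 + min ε₁ ε₂) * b →
      a ≤ ENNReal.ofReal (1 + ε) * b :=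
    fun hε h => h.trans (mul_le_mul' (ENNReal.ofReal_le_ofReal (by linarith)) le_rfl)
  have hTI : Literature.Analysis.FluidPDE.IsTypeIBlowup u T :=
    hlean νc T hνc0 hT u p hmax hLH hw.2.2 hglob (fun v hv hKv => hle (min_le_left _ _) (hmin νc hνc v hv hKv))
  obtain ⟨x₀, U, c, R, -, hc, hmild, hmeas, hdss, hdecU, hne⟩ :=
    hper νc T hνc0 hT u p hmax hLH hw.2.2 hglob (fun v hv hKv => hle (min_le_right _ _) (hmin νc hνc v hv hKv)) hTI
  exact hne ((hW c).2 R hc U hmild hmeas hdss hdecU)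

end Summit.NavierStokesRegularity.NavierStokesRegularity.Theses.RootDecompThresholdSaddle
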